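import Mathlib
import HarnessLib.Audit
import Summits.PneNP.PneNP.Theorems.PstarTerminalPeelableFourteen
import Summits.PneNP.PneNP.Theorems.PstarChordReadSlackGeneral

/-!
# O1 from one genericity statement: `TerminalPeelable` modulo `GenericChords` (ROUND-24, O1; memo g22 §24)

FRONTIER range-avoidance ladder, rung F-N3, ROUND 24 (cell `pnp-ideate`, prover-2 memo `g22/O1-PAIRCORE-g22.md` §24; typed target
`PstarCoreBoundTargets.TerminalPeelable` (p646951); restricted-model proof complexity — nothing here bears on `P` versus `NP`).

`PstarChordReadSlackGeneral.false_of_generic_chords`: a terminal core with `2·#bdry J₀ ≤ 3·#J₀ + t` has no `t + 2` distinct slice-generic chords.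
Hence the whole O1 target follows from ONE census-type statement about centre structures:

* `GenericChords` (OPEN): every terminal core carrying a centre cycle (a non-empty leafless set of non-chords) has a set `𝒞` of slice-generic
  chords with `2·#bdry J₀ + 2 ≤ 3·#J₀ + #𝒞` — i.e. at least `t + 2` of them, `t = 2·#bdry J₀ − 3·#J₀` the boundary slack (`t ≤ #J₀ − 12` with a
  centre cycle).  Its instances `#J₀ = 12, 13, 14` are `TwoGenericTwelve`, `ThreeGenericThirteen`, `FourGenericFourteen`;
* **`terminalPeelable_of_genericChords : GenericChords → TerminalPeelable`** — O1 for ALL core sizes, conditional on `GenericChords` only.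

No Assumption A.
-/

set_option linter.dupNamespace false -- `Summit.PneNP.PneNP.…`: summit = sub-problem name (D-0017 single-conjunct layout)

open Finset Literature.Computability.Complexity
open Summit.PneNP.PneNP.Theorems.PstarTyped (Typed)
open Summit.PneNP.PneNP.Theorems.PstarSALevel (bdry BoundaryExpanding SimpleOverlap)
open Summit.PneNP.PneNP.Theorems.PstarXCore (xverts)
open Summit.PneNP.PneNP.Theorems.PstarChordRepair (IsChord)
open Summit.PneNP.PneNP.Theorems.PstarCoreBoundTargets (Terminal nonchords TerminalPeelable)
open Summit.PneNP.PneNP.Theorems.PstarChordBridgeTools (xpdeg)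
open Summit.PneNP.PneNP.Theorems.PstarChordBridgeCotree (Peelable)
open Summit.PneNP.PneNP.Theorems.PstarChordReadLemma (SliceGeneric)
open Summit.PneNP.PneNP.Theorems.PstarTerminalPeelableTwelve (exists_centre_of_not_peelable)
open Summit.PneNP.PneNP.Theorems.PstarChordReadSlackGeneral (false_of_generic_chords)

namespace Summit.PneNP.PneNP.Theorems.PstarTerminalPeelableGeneric

/-- **`GenericChords` (OPEN): `t + 2` slice-generic chords on every centre structure of boundary slack `t`.**  For every pure typed
`(r,3/2)`-expanding instance with simple overlaps and every terminal core `(J₀, w₁, w₂)` carrying a non-empty leafless set of non-chords, there is a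
set `𝒞 ⊆ J₀` of chords, each slice-generic for the menu `G₁ ∪ G₂`, with `2·#bdry J₀ + 2 ≤ 3·#J₀ + #𝒞`.  FRONTIER (census side of O1). -/
@[conjecture] def GenericChords : Prop :=
  ∀ (n m r : ℕ) (I : LocalMap 4 n m), I.IsPure xorAndPred → Typed I → SimpleOverlap I → BoundaryExpanding r I →
    ∀ (y : Fin m → Bool) (J₀ : Finset (Fin m)) (w₁ w₂ : Finset (Fin n) × Finset (Fin m) × Bool), Terminal I r y J₀ w₁ w₂ →
      (∃ S ⊆ J₀, S.Nonempty ∧ (∀ w ∈ xverts I S, 2 ≤ xpdeg I S w) ∧ ∀ f ∈ S, ¬ IsChord I J₀ f) →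
      ∃ 𝒞 ⊆ J₀, (∀ c ∈ 𝒞, IsChord I J₀ c) ∧ (∀ c ∈ 𝒞, SliceGeneric I y J₀ c (w₁.2.1 ∪ w₂.2.1)) ∧
        2 * (bdry I J₀).card + 2 ≤ 3 * J₀.card + 𝒞.card

/-- **O1 FROM `GenericChords`**: every terminal core has leaf-peelable non-chords. -/
theorem terminalPeelable_of_genericChords (h : GenericChords) : TerminalPeelable := by
  intro n m r I hI hT hS hB y J₀ w₁ w₂ ht
  by_contra hnp
  obtain ⟨S, hSJ, hne, hL, hnc⟩ := exists_centre_of_not_peelable I hnp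
  obtain ⟨𝒞, h𝒞J, hch, hgen, hcount⟩ := h n m r I hI hT hS hB y J₀ w₁ w₂ ht ⟨S, hSJ, hne, hL, hnc⟩
  have hexp := hB J₀ ht.2.2.1.le
  exact false_of_generic_chords hI hT hS hB ht (t := 𝒞.card - 2) (by omega) h𝒞J hch hgen (by omega)

end Summit.PneNP.PneNP.Theorems.PstarTerminalPeelableGeneric
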